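import Mathlib
import Summits.NavierStokesRegularity.NavierStokesRegularity.Theorems.LerayQuarterDissipationFiniteDissipationLiouvilleWindowRecurrence
import HarnessLib

/-!
# Crux `FiniteDissipationLiouville` (stmt-NavierStokesRegularity-22144): THE VOLUME FLOORS AT EVERY
# SCALE (`≥ η c⁵` in the window `[−c², −εc²]`) AND INSIDE THE SELF-SIMILAR CORE

Theorems file of route `LerayQuarterDissipation` (lead prover g19; `--supports` the crux; sequel of
`…WindowSocket` / `…WindowRecurrence`). Navier–Stokes regularity is NOT proved by anything here; no
summit is.

`…WindowRecurrence` states the volume floors in the UNIT window `[−1, −ε] × ℝ³` («apply to `V_c` for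
other windows»). This file performs the change of variables once and for all:

* `isAddHaarMeasure_volume_prod` — Lebesgue measure on `ℝ × ℝ³` is an additive Haar measure, so
  Mathlib's `addHaar_preimage_linearMap` applies to the PARABOLIC DILATION `(t, x) ↦ (c²t, c x)`,
  a linear map of determinant `c⁵` (`det_parabolicDilation`, `volume_preimage_parabolicDilation`);
* **`volume_window_scaled`** — for any pointwise hypothesis `G` with the scale covariance of the
  window socket, a unit-window floor `vol{(t,x) ∈ [−1,−ε] × ℝ³ : ¬G (V_c)} ≥ η` gives
  `vol{(t,x) ∈ [−c², −εc²] × ℝ³ : ¬G V} ≥ η c⁵`;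
* instances: **`speed_exceeds_one_volume_scaled`** (for every singular enveloped Type-I field and
  EVERY `c > 0`, the fast set `{√(−t)‖u‖ > 1}` meets `[−c², −εc²] × ℝ³` in volume `≥ η(A) c⁵`),
  **`localBalance_excess_volume_scaled`** (the same for the Lamb-form production excess);
* **the fast set lives in the self-similar core**: under the envelope `‖u‖ ≤ A/(‖x‖ + √(−t))` a fast
  point has `‖x‖ < (A − 1)√(−t)` (`norm_lt_of_fast`), so the fast part of the window `[−c², −εc²]`
  is contained in the parabolic core `{‖x‖ < (A−1)√(−t)}` (of volume `≍ A³c⁵`) while having volume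
  `≥ η(A)c⁵` (`speed_exceeds_one_volume_core`): **at every scale the super-self-similar fluid
  occupies a definite, scale-independent FRACTION of the self-similar core** of the hypothetical
  singular profile (the fraction `η(A)/((4π/3)(1−ε)(A−1)³)` is not evaluated here).

HONEST FRAMING. Bookkeeping (a linear change of variables) on top of the compactness corollaries
of `…WindowRecurrence`; constants ineffective; statements about a HYPOTHETICAL object. Nothing is
removed from the DSS wall (`∀ c>1 TypeIDSSLiouville c`, NECESSARY for the crux). Nothing here
bears on NS regularity.

References: Koch–Nadirashvili–Seregin–Šverák, Acta Math. 203 (2009) §4; folklore.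
-/

noncomputable section

set_option linter.dupNamespace false

namespace Summit.NavierStokesRegularity.NavierStokesRegularity.Theorems.FiniteDissipationLiouville.WindowRecurrence

open MeasureTheory Set Filter Topology Metric InnerProductSpace Function Real
open scoped RealInnerProductSpace ContDiff ENNReal
open Literature.Analysis Literature.Analysis.FluidPDE
open Summit.NavierStokesRegularity.NavierStokesRegularity.Theorems
open Summit.NavierStokesRegularity.NavierStokesRegularity.Theorems.RecurrentReductionD
open Summit.NavierStokesRegularity.NavierStokesRegularity.Theorems.FiniteDissipationLiouville
open Summit.NavierStokesRegularity.NavierStokesRegularity.Theorems.FiniteDissipationLiouville.CrossFlow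
open Summit.NavierStokesRegularity.NavierStokesRegularity.Theorems.FiniteDissipationLiouville.WindowSocket

/-! ### The parabolic dilation of space–time and its Jacobian -/

section Dilation

/-- Lebesgue measure on `ℝ × ℝ³` is an additive Haar measure. [folklore] -/
theorem isAddHaarMeasure_volume_prod :
    (volume : Measure (ℝ × EuclideanSpace ℝ (Fin 3))).IsAddHaarMeasure := by
  rw [Measure.volume_eq_prod]
  infer_instance

/-- The determinant of the parabolic dilation `(t, x) ↦ (c²t, c x)` of `ℝ × ℝ³` is `c⁵`. [folklore] -/
theorem det_parabolicDilation (c : ℝ) :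
    LinearMap.det (LinearMap.prodMap ((c ^ 2) • (LinearMap.id : ℝ →ₗ[ℝ] ℝ))
      (c • (LinearMap.id : EuclideanSpace ℝ (Fin 3) →ₗ[ℝ] EuclideanSpace ℝ (Fin 3)))) = c ^ 5 := by
  rw [LinearMap.det_prodMap, LinearMap.det_smul, LinearMap.det_smul, LinearMap.det_id,
    LinearMap.det_id, Module.finrank_self, finrank_euclideanSpace, Fintype.card_fin]
  ring

/-- **Volume of preimages under the parabolic dilation**: for `c > 0` and any set `T ⊆ ℝ × ℝ³`,
`vol{(t,x) : (c²t, c x) ∈ T} = c⁻⁵ vol(T)`. [folklore] -/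
theorem volume_preimage_parabolicDilation {c : ℝ} (hc : 0 < c) (T : Set (ℝ × EuclideanSpace ℝ (Fin 3))) :
    volume {p : ℝ × EuclideanSpace ℝ (Fin 3) | (c ^ 2 * p.1, c • p.2) ∈ T} =
      ENNReal.ofReal ((c ^ 5)⁻¹) * volume T := by
  haveI := isAddHaarMeasure_volume_prod
  set Φ : ℝ × EuclideanSpace ℝ (Fin 3) →ₗ[ℝ] ℝ × EuclideanSpace ℝ (Fin 3) :=
    LinearMap.prodMap ((c ^ 2) • (LinearMap.id : ℝ →ₗ[ℝ] ℝ))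
      (c • (LinearMap.id : EuclideanSpace ℝ (Fin 3) →ₗ[ℝ] EuclideanSpace ℝ (Fin 3))) with hΦ
  have hdet : LinearMap.det Φ = c ^ 5 := det_parabolicDilation c
  have hdet0 : LinearMap.det Φ ≠ 0 := by rw [hdet]; positivity
  have hpre : {p : ℝ × EuclideanSpace ℝ (Fin 3) | (c ^ 2 * p.1, c • p.2) ∈ T} = Φ ⁻¹' T := by
    ext p
    simp only [mem_setOf_eq, mem_preimage, hΦ, LinearMap.prodMap_apply, LinearMap.smul_apply,
      LinearMap.id_coe, id_eq, smul_eq_mul]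
  rw [hpre, Measure.addHaar_preimage_linearMap _ hdet0, hdet, abs_of_pos (by positivity)]

/-- **THE VOLUME FLOOR AT EVERY SCALE.** For a pointwise hypothesis `G` with the window socket's
scale covariance (`G V (c²t) (c x) ⇒ G V_c t x`), a floor `η ≤ vol{(t,x) ∈ [−1,−ε] × ℝ³ : ¬G V_c}`
in the unit window of the rescaled field gives `η c⁵ ≤ vol{(t,x) ∈ [−c²,−εc²] × ℝ³ : ¬G V}`.
[folklore] -/
theorem volume_window_scaled
    {G : (ℝ → EuclideanSpace ℝ (Fin 3) → EuclideanSpace ℝ (Fin 3)) → ℝ → EuclideanSpace ℝ (Fin 3) → Prop}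
    (hGscale : ∀ (V : ℝ → EuclideanSpace ℝ (Fin 3) → EuclideanSpace ℝ (Fin 3)) (c t : ℝ)
      (x : EuclideanSpace ℝ (Fin 3)), 0 < c → t < 0 → G V (c ^ 2 * t) (c • x) → G (nsRescale c V) t x)
    {V : ℝ → EuclideanSpace ℝ (Fin 3) → EuclideanSpace ℝ (Fin 3)} {ε η c : ℝ} (hε : 0 < ε)
    (hc : 0 < c)
    (h : ENNReal.ofReal η ≤ volume {p : ℝ × EuclideanSpace ℝ (Fin 3) |
      p.1 ∈ Icc (-1 : ℝ) (-ε) ∧ ¬ G (nsRescale c V) p.1 p.2}) :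
    ENNReal.ofReal (η * c ^ 5) ≤ volume {p : ℝ × EuclideanSpace ℝ (Fin 3) |
      p.1 ∈ Icc (-c ^ 2) (-(ε * c ^ 2)) ∧ ¬ G V p.1 p.2} := by
  set T : Set (ℝ × EuclideanSpace ℝ (Fin 3)) :=
    {p | p.1 ∈ Icc (-c ^ 2) (-(ε * c ^ 2)) ∧ ¬ G V p.1 p.2} with hT
  have hc2 : 0 < c ^ 2 := by positivity
  have hc5 : 0 < c ^ 5 := by positivity
  -- the unit-window violation set of `V_c` dilates into `T`
  have hsub : {p : ℝ × EuclideanSpace ℝ (Fin 3) | p.1 ∈ Icc (-1 : ℝ) (-ε) ∧ ¬ G (nsRescale c V) p.1 p.2}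
      ⊆ {p : ℝ × EuclideanSpace ℝ (Fin 3) | (c ^ 2 * p.1, c • p.2) ∈ T} := by
    intro p hp
    obtain ⟨⟨h1, h2⟩, hbad⟩ := hp
    have ht : p.1 < 0 := by linarith
    refine ⟨⟨by nlinarith, by nlinarith⟩, fun hG => hbad (hGscale V c p.1 p.2 hc ht hG)⟩
  have h1 := (h.trans (measure_mono hsub)).trans_eq (volume_preimage_parabolicDilation hc T)
  calc ENNReal.ofReal (η * c ^ 5) = ENNReal.ofReal (c ^ 5) * ENNReal.ofReal η := by
        rw [mul_comm, ENNReal.ofReal_mul hc5.le]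
    _ ≤ ENNReal.ofReal (c ^ 5) * (ENNReal.ofReal ((c ^ 5)⁻¹) * volume T) := by gcongr
    _ = volume T := by
        rw [← mul_assoc, ← ENNReal.ofReal_mul hc5.le, mul_inv_cancel₀ hc5.ne', ENNReal.ofReal_one,
          one_mul]

end Dilation

/-! ### The floors at every scale -/

section Scaled

/-- Pointwise scale covariance of «speed `≤ 1`». [folklore] -/
theorem speed_le_one_at_nsRescale (V : ℝ → EuclideanSpace ℝ (Fin 3) → EuclideanSpace ℝ (Fin 3))
    {c t : ℝ} (x : EuclideanSpace ℝ (Fin 3)) (hc : 0 < c) (ht : t < 0)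
    (h : Real.sqrt (-(c ^ 2 * t)) * ‖V (c ^ 2 * t) (c • x)‖ ≤ 1) :
    Real.sqrt (-t) * ‖nsRescale c V t x‖ ≤ 1 := by
  have e : Real.sqrt (-(c ^ 2 * t)) = c * Real.sqrt (-t) := by
    rw [show -(c ^ 2 * t) = c ^ 2 * (-t) by ring, Real.sqrt_mul' _ (neg_nonneg.2 ht.le),
      Real.sqrt_sq hc.le]
  rw [nsRescale_apply, norm_smul, Real.norm_of_nonneg hc.le]
  rw [e] at h
  linarith [h]

/-- **THE FAST SET HAS VOLUME `≥ η c⁵` IN EVERY WINDOW `[−c², −εc²]`.** With `ε(A)`, `η(A)` as in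
`…WindowRecurrence.speed_exceeds_one_volume`: for every singular KNSS-gauge Type-I field
(`IsTypeIAncientMild C V`, `C ≤ A`) with a Type-I envelope `HasTypeIDecay A V` and every `c > 0`,
`vol{(t,x) ∈ [−c², −εc²] × ℝ³ : √(−t)‖V(t,x)‖ > 1} ≥ η c⁵`.
[folklore; cite: KochNadirashviliSereginSverak2009, §4 (arXiv:0709.3599 p. 8)] -/
theorem speed_exceeds_one_volume_scaled (A : ℝ) : ∃ ε : ℝ, 0 < ε ∧ ε < 1 ∧ ∃ η : ℝ, 0 < η ∧
    ∀ (C : ℝ) (V : ℝ → EuclideanSpace ℝ (Fin 3) → EuclideanSpace ℝ (Fin 3)),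
      IsTypeIAncientMild C V → C ≤ A → HasTypeIDecay A V →
      (∀ r > 0, ∀ M : ℝ, ∃ t ∈ Ioo (-(r ^ 2)) (0 : ℝ),
        ∃ x ∈ ball (0 : EuclideanSpace ℝ (Fin 3)) r, M < ‖V t x‖) →
      ∀ c : ℝ, 0 < c →
      ENNReal.ofReal (η * c ^ 5) ≤ volume {p : ℝ × EuclideanSpace ℝ (Fin 3) |
        p.1 ∈ Icc (-c ^ 2) (-(ε * c ^ 2)) ∧ 1 < Real.sqrt (-p.1) * ‖V p.1 p.2‖} := by
  obtain ⟨ε, hε, hε1, η, hη, h⟩ := speed_exceeds_one_volume A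
  refine ⟨ε, hε, hε1, η, hη, fun C V hV hCA hdec hsing c hc => ?_⟩
  have h1 := h C (nsRescale c V) (hV.nsRescale hc) hCA (hdec.nsRescale hc)
    (singularAtOrigin_nsRescale hsing hc)
  have h2 := volume_window_scaled (G := fun F t x => Real.sqrt (-t) * ‖F t x‖ ≤ 1)
    (fun F c' t x hc' ht hG => speed_le_one_at_nsRescale F x hc' ht hG) hε hc (V := V) (η := η)
    (h1.trans (measure_mono fun p hp => ⟨hp.1, not_le.2 hp.2⟩))
  exact h2.trans (measure_mono fun p hp => ⟨hp.1, not_le.1 hp.2⟩)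

/-- **THE LAMB-FORM PRODUCTION EXCESS HAS VOLUME `≥ η c⁵` IN EVERY WINDOW `[−c², −εc²]`.**
[folklore; cite: KochNadirashviliSereginSverak2009, §4 (arXiv:0709.3599 p. 8)] -/
theorem localBalance_excess_volume_scaled (A : ℝ) : ∃ ε : ℝ, 0 < ε ∧ ε < 1 ∧ ∃ η : ℝ, 0 < η ∧
    ∀ (C : ℝ) (V : ℝ → EuclideanSpace ℝ (Fin 3) → EuclideanSpace ℝ (Fin 3)),
      IsTypeIAncientMild C V → C ≤ A → HasTypeIDecay A V →
      (∀ r > 0, ∀ M : ℝ, ∃ t ∈ Ioo (-(r ^ 2)) (0 : ℝ),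
        ∃ x ∈ ball (0 : EuclideanSpace ℝ (Fin 3)) r, M < ‖V t x‖) →
      ∀ c : ℝ, 0 < c →
      ENNReal.ofReal (η * c ^ 5) ≤ volume {p : ℝ × EuclideanSpace ℝ (Fin 3) |
        p.1 ∈ Icc (-c ^ 2) (-(ε * c ^ 2)) ∧
        ‖curl (curl (V p.1)) p.2‖ ^ 2 + ‖curl (V p.1) p.2‖ ^ 2 / (4 * (-p.1)) <
          ⟪V p.1 p.2, cross (curl (V p.1) p.2) (curl (curl (V p.1)) p.2)⟫} := by
  obtain ⟨ε, hε, hε1, η, hη, h⟩ := localBalance_excess_volume A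
  refine ⟨ε, hε, hε1, η, hη, fun C V hV hCA hdec hsing c hc => ?_⟩
  have h1 := h C (nsRescale c V) (hV.nsRescale hc) hCA (hdec.nsRescale hc)
    (singularAtOrigin_nsRescale hsing hc)
  have h2 := volume_window_scaled
    (G := fun F t x => ⟪F t x, cross (curl (F t) x) (curl (curl (F t)) x)⟫ ≤
      ‖curl (curl (F t)) x‖ ^ 2 + ‖curl (F t) x‖ ^ 2 / (4 * (-t)))
    (fun F c' t x hc' ht hG => localBalance_at_nsRescale F x hc' ht hG) hε hc (V := V) (η := η)
    (h1.trans (measure_mono fun p hp => ⟨hp.1, not_le.2 hp.2⟩))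
  exact h2.trans (measure_mono fun p hp => ⟨hp.1, not_le.1 hp.2⟩)

end Scaled

/-! ### The fast set lives in the self-similar core -/

section Core

/-- **A fast point is central**: under the envelope `‖V(t,x)‖ ≤ A/(‖x‖ + √(−t))`, a point with
`√(−t)‖V(t,x)‖ > 1` has `‖x‖ < (A − 1)√(−t)`. [folklore] -/
theorem norm_lt_of_fast {A t : ℝ} {V : ℝ → EuclideanSpace ℝ (Fin 3) → EuclideanSpace ℝ (Fin 3)}
    (hdec : HasTypeIDecay A V) (ht : t < 0) {x : EuclideanSpace ℝ (Fin 3)}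
    (hfast : 1 < Real.sqrt (-t) * ‖V t x‖) : ‖x‖ < (A - 1) * Real.sqrt (-t) := by
  have hs : 0 < Real.sqrt (-t) := Real.sqrt_pos.2 (neg_pos.2 ht)
  have hden : 0 < ‖x‖ + Real.sqrt (-t) := by positivity
  have h1 := hdec t ht x
  have h2 : Real.sqrt (-t) * ‖V t x‖ ≤ Real.sqrt (-t) * (A / (‖x‖ + Real.sqrt (-t))) :=
    mul_le_mul_of_nonneg_left h1 hs.le
  have h3 : 1 < Real.sqrt (-t) * (A / (‖x‖ + Real.sqrt (-t))) := hfast.trans_le h2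
  rw [mul_div_assoc', lt_div_iff₀ hden] at h3
  linarith

/-- **THE FAST SET FILLS A DEFINITE FRACTION OF THE SELF-SIMILAR CORE, AT EVERY SCALE.** With
`ε(A)`, `η(A)`: for every singular enveloped member and every `c > 0`, the fast part of the window
`[−c², −εc²] × ℝ³` is contained in the parabolic core `{‖x‖ < (A−1)√(−t)}` and has volume `≥ η c⁵`.
[folklore; cite: KochNadirashviliSereginSverak2009, §4 (arXiv:0709.3599 p. 8)] -/
theorem speed_exceeds_one_volume_core (A : ℝ) : ∃ ε : ℝ, 0 < ε ∧ ε < 1 ∧ ∃ η : ℝ, 0 < η ∧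
    ∀ (C : ℝ) (V : ℝ → EuclideanSpace ℝ (Fin 3) → EuclideanSpace ℝ (Fin 3)),
      IsTypeIAncientMild C V → C ≤ A → HasTypeIDecay A V →
      (∀ r > 0, ∀ M : ℝ, ∃ t ∈ Ioo (-(r ^ 2)) (0 : ℝ),
        ∃ x ∈ ball (0 : EuclideanSpace ℝ (Fin 3)) r, M < ‖V t x‖) →
      ∀ c : ℝ, 0 < c →
      {p : ℝ × EuclideanSpace ℝ (Fin 3) | p.1 ∈ Icc (-c ^ 2) (-(ε * c ^ 2)) ∧
          1 < Real.sqrt (-p.1) * ‖V p.1 p.2‖} ⊆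
        {p : ℝ × EuclideanSpace ℝ (Fin 3) | p.1 ∈ Icc (-c ^ 2) (-(ε * c ^ 2)) ∧
          ‖p.2‖ < (A - 1) * Real.sqrt (-p.1)} ∧
      ENNReal.ofReal (η * c ^ 5) ≤ volume {p : ℝ × EuclideanSpace ℝ (Fin 3) |
        p.1 ∈ Icc (-c ^ 2) (-(ε * c ^ 2)) ∧ 1 < Real.sqrt (-p.1) * ‖V p.1 p.2‖} := by
  obtain ⟨ε, hε, hε1, η, hη, h⟩ := speed_exceeds_one_volume_scaled A
  refine ⟨ε, hε, hε1, η, hη, fun C V hV hCA hdec hsing c hc => ⟨fun p hp => ⟨hp.1, ?_⟩,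
    h C V hV hCA hdec hsing c hc⟩⟩
  have ht : p.1 < 0 := by
    have : 0 < ε * c ^ 2 := by positivity
    linarith [hp.1.2]
  exact norm_lt_of_fast hdec ht hp.2

end Core

end Summit.NavierStokesRegularity.NavierStokesRegularity.Theorems.FiniteDissipationLiouville.WindowRecurrence

end
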